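import Summits.KontsevichZagierPeriods.KontsevichZagierPeriods.Theorems.TerasomaMultiplicationBetaCancellationFibreSubstitutionTwoCatalysts

/-!
# `BetaCancellation` (stmt-KontsevichZagierPeriods-13633), line `dirichlet-companion-to-pi` — stub `stub_twoPieceFibreSubstitution`

**Two-piece fibre-form substitutions descend when the catalyst fractions are algebraic.** Let
`p = [K, k]` be a catalyst of dimension `d`, split `K = K₁ ⊔ K₂` into two disjoint `ℚ`-semialgebraic
pieces of non-zero mass `κᵢ = ∫_{Kᵢ} k`, and assume the mass fractions are ALGEBRAIC:
`cᵢ · p.value = κᵢ` with `cᵢ` real algebraic. Let `q = p ⊗ r`, `q' = p ⊗ r'` be pinned products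
(catalyst first, `Fin.castAdd n i`; factor last, `Fin.natAdd d j`) related by ONE change of variables
`Φ` (derivative `Φ'` within `q.domain`, injective, `q'.domain = Φ '' q.domain`, Jacobian identity)
which is of FIBRE FORM PIECEWISE: `tail (Φ z) = ψᵢ (tail z)` whenever `head z ∈ Kᵢ`, with
`ψ₁, ψ₂` `ℚ`-semialgebraic on `σ = r.domain`, injective there, differentiable within `σ`, and with
DISJOINT images `ψ₁ σ`, `ψ₂ σ`. Then `r ∼ r'` (`stub_twoPieceFibreSubstitution`).

Proof. (0) `p.value = κ₁ + κ₂` (`MeasureTheory.setIntegral_union`), so `p.value ≠ 0` and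
`c₁ + c₂ = 1`. (1)–(4) Piece `i` is a catalyst exchange in the sense of
`stub_fibreSubstitutionTwoCatalysts`: the catalyst piece `pᵢ = p|Kᵢ` (`KZ.IntegralRep.restrict`,
value `κᵢ ≠ 0`), the source piece `qᵢ = q|{head ∈ Kᵢ}` pinned over `r` with catalyst `pᵢ`, the
target piece `q'ᵢ = q'|{tail ∈ ψᵢ σ}` pinned over `r'ᵢ = r'|ψᵢσ` with catalyst `p` (`ψᵢ σ ⊆ σ'`
by slicing at a point of `Kᵢ`; `ψᵢ σ` is semialgebraic by Tarski–Seidenberg,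
`IsSemialgebraicMapOn.isSemialgebraic_image_holds`), and the one-move data restricted to `qᵢ`;
the image clause `q'ᵢ.domain = Φ '' qᵢ.domain` is where disjointness of the two images enters
(a point of `q'` with tail in `ψᵢ σ` cannot come from the other piece). (5) Hence
`r.constMul cᵢ ∼ r'ᵢ`. (6) `[r] − [c₁ r] − [c₂ r]` is an integrand-additivity instance
(`c₁ + c₂ = 1`), (7) `[r'] − [r'₁] − [r'₂]` is a domain-additivity instance (`σ' = ψ₁ σ ∪ ψ₂ σ`
by slicing, empty overlap), and (8) the four memberships combine in the free abelian group.
Example covered: `(t, w) ↦ (2t, w) ⊔ (2t − 1, 2w)` certifying `[(0,1)×(1,2), 1/w] ∼ [(0,1)×(1,4), 1/(2w)]`.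
No definitions; sorry-free; axioms ⊆ {propext, Classical.choice, Quot.sound}.

References: M. Kontsevich, D. Zagier, *Periods* (2001), §1.2 rules (1), (2).
-/

noncomputable section

-- `Summit.KontsevichZagierPeriods.KontsevichZagierPeriods.…` is the tree's mandated layout (single-conjunct summit).
set_option linter.dupNamespace false

namespace Summit.KontsevichZagierPeriods.KontsevichZagierPeriods.BetaCancellationLine

open MeasureTheory Set
open Literature.ModelTheory.ExponentialFields (IsSemialgebraic)
open Literature.NumberTheory.Transcendental
open Literature.NumberTheory.Transcendental.KZ

/-! ### Slicing helpers -/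

/-- A set over which some function has non-zero integral is non-empty (`∫_∅ g = 0`). [folklore] -/
theorem twoPiece_nonempty_of_setIntegral_ne_zero {d : ℕ} {K : Set (Fin d → ℝ)}
    {g : (Fin d → ℝ) → ℝ} (h : ∫ x in K, g x ≠ 0) : K.Nonempty := by
  by_contra hK
  rw [not_nonempty_iff_eq_empty] at hK
  apply h
  rw [hK]
  simp

/-- **Slicing at a point of the piece.** If `Φ` maps the cylinder `D = K × σ` onto `D' = K × σ'` and
is of fibre form `ψ₁` over a non-empty piece `K₁ ⊆ K`, then `ψ₁ σ ⊆ σ'`: for `x₁ ∈ K₁` and `w ∈ σ`,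
`tail (Φ (x₁, w)) = ψ₁ w` lies in `σ'`. [folklore] -/
theorem twoPiece_image_subset {d n : ℕ} {K K₁ : Set (Fin d → ℝ)} (hK₁K : K₁ ⊆ K)
    (hK₁ : K₁.Nonempty) {σ σ' : Set (Fin n → ℝ)} {D D' : Set (Fin (d + n) → ℝ)}
    (hD : D = {z | (fun i => z (Fin.castAdd n i)) ∈ K ∧ (fun j => z (Fin.natAdd d j)) ∈ σ})
    (hD' : D' = {z | (fun i => z (Fin.castAdd n i)) ∈ K ∧ (fun j => z (Fin.natAdd d j)) ∈ σ'})
    (Φ : (Fin (d + n) → ℝ) → (Fin (d + n) → ℝ)) (himg : D' = Φ '' D)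
    (ψ₁ : (Fin n → ℝ) → (Fin n → ℝ))
    (hfib₁ : ∀ z ∈ D, (fun i => z (Fin.castAdd n i)) ∈ K₁ →
      (fun j => Φ z (Fin.natAdd d j)) = ψ₁ (fun j => z (Fin.natAdd d j))) :
    ψ₁ '' σ ⊆ σ' := by
  obtain ⟨x₁, hx₁⟩ := hK₁
  have hmemD : ∀ z, z ∈ D ↔
      (fun i => z (Fin.castAdd n i)) ∈ K ∧ (fun j => z (Fin.natAdd d j)) ∈ σ := fun z => by
    rw [hD]; rfl
  have hmemD' : ∀ z, z ∈ D' ↔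
      (fun i => z (Fin.castAdd n i)) ∈ K ∧ (fun j => z (Fin.natAdd d j)) ∈ σ' := fun z => by
    rw [hD']; rfl
  rintro _ ⟨w, hw, rfl⟩
  have hz : Fin.append x₁ w ∈ D := by
    rw [hmemD]
    simpa using And.intro (hK₁K hx₁) hw
  have hzK₁ : (fun i => Fin.append x₁ w (Fin.castAdd n i)) ∈ K₁ := by simpa using hx₁
  have hz' : Φ (Fin.append x₁ w) ∈ D' := himg ▸ mem_image_of_mem Φ hz
  rw [hmemD', hfib₁ _ hz hzK₁] at hz'
  simpa using hz'.2

/-- **Slicing the target.** If `Φ` maps `D = K × σ` onto `D' = K × σ'` (`K` non-empty) and is of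
fibre form `ψ₁` over `K₁` and `ψ₂` over `K₂` with `K₁ ∪ K₂ = K`, then `σ' ⊆ ψ₁ σ ∪ ψ₂ σ`: a point
`(x, w')` of `D'` is `Φ z` with `head z` in one of the pieces, and then `w' = ψᵢ (tail z)`. [folklore] -/
theorem twoPiece_subset_union_image {d n : ℕ} {K K₁ K₂ : Set (Fin d → ℝ)} (hKu : K₁ ∪ K₂ = K)
    (hK : K.Nonempty) {σ σ' : Set (Fin n → ℝ)} {D D' : Set (Fin (d + n) → ℝ)}
    (hD : D = {z | (fun i => z (Fin.castAdd n i)) ∈ K ∧ (fun j => z (Fin.natAdd d j)) ∈ σ})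
    (hD' : D' = {z | (fun i => z (Fin.castAdd n i)) ∈ K ∧ (fun j => z (Fin.natAdd d j)) ∈ σ'})
    (Φ : (Fin (d + n) → ℝ) → (Fin (d + n) → ℝ)) (himg : D' = Φ '' D)
    (ψ₁ ψ₂ : (Fin n → ℝ) → (Fin n → ℝ))
    (hfib₁ : ∀ z ∈ D, (fun i => z (Fin.castAdd n i)) ∈ K₁ →
      (fun j => Φ z (Fin.natAdd d j)) = ψ₁ (fun j => z (Fin.natAdd d j)))
    (hfib₂ : ∀ z ∈ D, (fun i => z (Fin.castAdd n i)) ∈ K₂ →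
      (fun j => Φ z (Fin.natAdd d j)) = ψ₂ (fun j => z (Fin.natAdd d j))) :
    σ' ⊆ ψ₁ '' σ ∪ ψ₂ '' σ := by
  obtain ⟨x, hx⟩ := hK
  have hmemD : ∀ z, z ∈ D ↔
      (fun i => z (Fin.castAdd n i)) ∈ K ∧ (fun j => z (Fin.natAdd d j)) ∈ σ := fun z => by
    rw [hD]; rfl
  have hmemD' : ∀ z, z ∈ D' ↔
      (fun i => z (Fin.castAdd n i)) ∈ K ∧ (fun j => z (Fin.natAdd d j)) ∈ σ' := fun z => by
    rw [hD']; rfl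
  intro w' hw'
  have hz' : Fin.append x w' ∈ D' := by
    rw [hmemD']
    simpa using And.intro hx hw'
  rw [himg] at hz'
  obtain ⟨z, hz, hzw⟩ := hz'
  obtain ⟨hzK, hzσ⟩ := (hmemD z).1 hz
  have htail : (fun j => Φ z (Fin.natAdd d j)) = w' := by
    rw [hzw]
    funext j
    simp
  rw [← hKu] at hzK
  rcases hzK with h₁ | h₂
  · exact Or.inl ⟨_, hzσ, by rw [← hfib₁ z hz h₁, htail]⟩
  · exact Or.inr ⟨_, hzσ, by rw [← hfib₂ z hz h₂, htail]⟩

/-! ### One piece is a catalyst exchange -/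

/-- **Piece descent.** In the situation of `stub_twoPieceFibreSubstitution`, fix ONE piece `K₁ ⊆ K`
(`ℚ`-semialgebraic, mass `κ₁ = ∫_{K₁} k ≠ 0`, algebraic fraction `c₁ · p.value = κ₁`) over which
`Φ` is of fibre form `ψ₁`, and assume that points of `q.domain` with head OUTSIDE `K₁` are not sent
by `tail ∘ Φ` into `ψ₁ σ`. Then for any representation `r'₁` with domain `ψ₁ σ` and the integrand
of `r'`, `r.constMul c₁ ∼ r'₁`: the restrictions `p|K₁ ⊗ r → p ⊗ r'₁` of the one-move data form a
catalyst exchange (`stub_fibreSubstitutionTwoCatalysts`), the image clause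
`q'|{tail ∈ ψ₁σ} = Φ '' q|{head ∈ K₁}` being exactly the outside hypothesis.
[cite: KontsevichZagier2001, §1.2 rule (2)] -/
theorem twoPiece_pieceDescent {d n : ℕ} (p : IntegralRep d) (hκ : p.value ≠ 0)
    (K₁ : Set (Fin d → ℝ)) (hK₁s : IsSemialgebraic ℚ K₁) (hK₁K : K₁ ⊆ p.domain)
    (hv₁ : ∫ x in K₁, p.integrand x ≠ 0)
    (c₁ : ℝ) (hc₁ : IsAlgebraic ℚ c₁) (hc₁v : c₁ * p.value = ∫ x in K₁, p.integrand x)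
    (r r' : IntegralRep n) (q q' : IntegralRep (d + n))
    (hq : q.domain = {z | (fun i => z (Fin.castAdd n i)) ∈ p.domain ∧
      (fun j => z (Fin.natAdd d j)) ∈ r.domain})
    (hqi : Set.EqOn q.integrand (fun z => p.integrand (fun i => z (Fin.castAdd n i)) *
      r.integrand (fun j => z (Fin.natAdd d j))) q.domain)
    (hq' : q'.domain = {z | (fun i => z (Fin.castAdd n i)) ∈ p.domain ∧
      (fun j => z (Fin.natAdd d j)) ∈ r'.domain})
    (hq'i : Set.EqOn q'.integrand (fun z => p.integrand (fun i => z (Fin.castAdd n i)) *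
      r'.integrand (fun j => z (Fin.natAdd d j))) q'.domain)
    (Φ : (Fin (d + n) → ℝ) → (Fin (d + n) → ℝ))
    (Φ' : (Fin (d + n) → ℝ) → (Fin (d + n) → ℝ) →L[ℝ] (Fin (d + n) → ℝ))
    (hΦ' : ∀ z ∈ q.domain, HasFDerivWithinAt Φ (Φ' z) q.domain z) (hΦinj : Set.InjOn Φ q.domain)
    (himg : q'.domain = Φ '' q.domain)
    (hjac : ∀ z ∈ q.domain, q.integrand z = q'.integrand (Φ z) * |(Φ' z).det|)
    (ψ₁ : (Fin n → ℝ) → (Fin n → ℝ)) (ψ₁' : (Fin n → ℝ) → (Fin n → ℝ) →L[ℝ] (Fin n → ℝ))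
    (hψ₁sa : IsSemialgebraicMapOn ℚ r.domain ψ₁)
    (hfib₁ : ∀ z ∈ q.domain, (fun i => z (Fin.castAdd n i)) ∈ K₁ →
      (fun j => Φ z (Fin.natAdd d j)) = ψ₁ (fun j => z (Fin.natAdd d j)))
    (hψ₁' : ∀ w ∈ r.domain, HasFDerivWithinAt ψ₁ (ψ₁' w) r.domain w)
    (hψ₁inj : Set.InjOn ψ₁ r.domain)
    (hout : ∀ z ∈ q.domain, (fun i => z (Fin.castAdd n i)) ∉ K₁ →
      (fun j => Φ z (Fin.natAdd d j)) ∉ ψ₁ '' r.domain)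
    (r'₁ : IntegralRep n) (hr'₁ : r'₁.domain = ψ₁ '' r.domain)
    (hr'₁i : r'₁.integrand = r'.integrand) :
    Equivalent (r.constMul c₁ hc₁) r'₁ := by
  -- membership in the two pinned products
  have hmemq : ∀ z, z ∈ q.domain ↔ (fun i => z (Fin.castAdd n i)) ∈ p.domain ∧
      (fun j => z (Fin.natAdd d j)) ∈ r.domain := fun z => by rw [hq]; rfl
  have hmemq' : ∀ z, z ∈ q'.domain ↔ (fun i => z (Fin.castAdd n i)) ∈ p.domain ∧
      (fun j => z (Fin.natAdd d j)) ∈ r'.domain := fun z => by rw [hq']; rfl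
  -- `ψ₁ σ ⊆ σ'` (slice at a point of `K₁`, non-empty since `κ₁ ≠ 0`)
  have hsub : ψ₁ '' r.domain ⊆ r'.domain :=
    twoPiece_image_subset hK₁K (twoPiece_nonempty_of_setIntegral_ne_zero hv₁) hq hq' Φ himg ψ₁ hfib₁
  -- (1) the catalyst piece `p₁ = p|K₁`, of value `κ₁`
  obtain ⟨p₁, hp₁d, hp₁i⟩ : ∃ p₁ : IntegralRep d, p₁.domain = K₁ ∧ p₁.integrand = p.integrand :=
    ⟨p.restrict K₁ hK₁s hK₁K, rfl, rfl⟩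
  have hp₁v : p₁.value = ∫ x in K₁, p.integrand x := by
    rw [IntegralRep.value, hp₁d, hp₁i]
  have hp₁ : p₁.value ≠ 0 := by
    rw [hp₁v]
    exact hv₁
  have hc₁v' : c₁ * p.value = p₁.value := by
    rw [hp₁v]
    exact hc₁v
  -- (2) the source piece `q₁ = q|{head ∈ K₁}`, pinned over `r` with catalyst `p₁`
  have hS : IsSemialgebraic ℚ (q.domain ∩ (fun z : Fin (d + n) → ℝ => z ∘ Fin.castAdd n) ⁻¹' K₁) :=
    q.isSemialgebraic_domain.inter (hK₁s.preimage_comp (Fin.castAdd n))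
  obtain ⟨q₁, hq₁d, hq₁i0⟩ : ∃ q₁ : IntegralRep (d + n),
      q₁.domain = q.domain ∩ (fun z : Fin (d + n) → ℝ => z ∘ Fin.castAdd n) ⁻¹' K₁ ∧
      q₁.integrand = q.integrand :=
    ⟨q.restrict _ hS inter_subset_left, rfl, rfl⟩
  have hmemq₁ : ∀ z, z ∈ q₁.domain ↔ z ∈ q.domain ∧ (fun i => z (Fin.castAdd n i)) ∈ K₁ :=
    fun z => by rw [hq₁d]; rfl
  have hsub₁ : q₁.domain ⊆ q.domain := fun z hz => ((hmemq₁ z).1 hz).1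
  have hq₁ : q₁.domain = {z | (fun i => z (Fin.castAdd n i)) ∈ p₁.domain ∧
      (fun j => z (Fin.natAdd d j)) ∈ r.domain} := by
    ext z
    rw [hmemq₁, hmemq, hp₁d, mem_setOf_eq]
    exact ⟨fun h => ⟨h.2, h.1.2⟩, fun h => ⟨⟨hK₁K h.1, h.2⟩, h.1⟩⟩
  have hq₁i : Set.EqOn q₁.integrand (fun z => p₁.integrand (fun i => z (Fin.castAdd n i)) *
      r.integrand (fun j => z (Fin.natAdd d j))) q₁.domain := by
    intro z hz
    rw [hq₁i0, hp₁i]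
    exact hqi (hsub₁ hz)
  -- (3) the target piece `q'₁ = q'|{tail ∈ ψ₁ σ}`, pinned over `r'₁` with catalyst `p`
  have hT : IsSemialgebraic ℚ
      (q'.domain ∩ (fun z : Fin (d + n) → ℝ => z ∘ Fin.natAdd d) ⁻¹' r'₁.domain) :=
    q'.isSemialgebraic_domain.inter (r'₁.isSemialgebraic_domain.preimage_comp (Fin.natAdd d))
  obtain ⟨q'₁, hq'₁d, hq'₁i0⟩ : ∃ q'₁ : IntegralRep (d + n),
      q'₁.domain = q'.domain ∩ (fun z : Fin (d + n) → ℝ => z ∘ Fin.natAdd d) ⁻¹' r'₁.domain ∧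
      q'₁.integrand = q'.integrand :=
    ⟨q'.restrict _ hT inter_subset_left, rfl, rfl⟩
  have hmemq'₁ : ∀ z, z ∈ q'₁.domain ↔
      z ∈ q'.domain ∧ (fun j => z (Fin.natAdd d j)) ∈ r'₁.domain :=
    fun z => by rw [hq'₁d]; rfl
  have hq'₁ : q'₁.domain = {z | (fun i => z (Fin.castAdd n i)) ∈ p.domain ∧
      (fun j => z (Fin.natAdd d j)) ∈ r'₁.domain} := by
    ext z
    rw [hmemq'₁, hmemq', mem_setOf_eq]
    refine ⟨fun h => ⟨h.1.1, h.2⟩, fun h => ⟨⟨h.1, ?_⟩, h.2⟩⟩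
    apply hsub
    rw [← hr'₁]
    exact h.2
  have hq'₁i : Set.EqOn q'₁.integrand (fun z => p.integrand (fun i => z (Fin.castAdd n i)) *
      r'₁.integrand (fun j => z (Fin.natAdd d j))) q'₁.domain := by
    intro z hz
    rw [hq'₁i0, hr'₁i]
    exact hq'i ((hmemq'₁ z).1 hz).1
  -- (4) the one-move data restricted to the piece
  have hΦ'₁ : ∀ z ∈ q₁.domain, HasFDerivWithinAt Φ (Φ' z) q₁.domain z :=
    fun z hz => (hΦ' z (hsub₁ hz)).mono hsub₁
  have hΦinj₁ : Set.InjOn Φ q₁.domain := hΦinj.mono hsub₁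
  have himg₁ : q'₁.domain = Φ '' q₁.domain := by
    apply Subset.antisymm
    · intro z' hz'
      obtain ⟨hz'q, hz't⟩ := (hmemq'₁ z').1 hz'
      rw [himg] at hz'q
      obtain ⟨z, hz, rfl⟩ := hz'q
      refine ⟨z, (hmemq₁ z).2 ⟨hz, ?_⟩, rfl⟩
      by_contra hK
      refine hout z hz hK ?_
      rw [← hr'₁]
      exact hz't
    · rintro _ ⟨z, hz, rfl⟩
      obtain ⟨hzq, hzK⟩ := (hmemq₁ z).1 hz
      refine (hmemq'₁ _).2 ⟨himg ▸ mem_image_of_mem Φ hzq, ?_⟩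
      rw [hr'₁, hfib₁ z hzq hzK]
      exact mem_image_of_mem ψ₁ ((hmemq z).1 hzq).2
  have hjac₁ : ∀ z ∈ q₁.domain, q₁.integrand z = q'₁.integrand (Φ z) * |(Φ' z).det| := by
    intro z hz
    rw [hq₁i0, hq'₁i0]
    exact hjac z (hsub₁ hz)
  have hfib₁' : ∀ z ∈ q₁.domain,
      (fun j => Φ z (Fin.natAdd d j)) = ψ₁ (fun j => z (Fin.natAdd d j)) :=
    fun z hz => hfib₁ z ((hmemq₁ z).1 hz).1 ((hmemq₁ z).1 hz).2
  -- (5) catalyst exchange `p₁ ⊗ r → p ⊗ r'₁`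
  exact stub_fibreSubstitutionTwoCatalysts p₁ p hp₁ hκ c₁ hc₁ hc₁v' r r'₁ q₁ q'₁ hq₁ hq₁i hq'₁
    hq'₁i Φ Φ' hΦ'₁ hΦinj₁ himg₁ hjac₁ ψ₁ ψ₁' hψ₁sa hfib₁' hψ₁' hψ₁inj

/-! ### The stub -/

/-- STUB (seat c14 cycle 4). **Two-piece fibre-form substitutions descend when the catalyst fractions are
algebraic.** Split the catalyst domain `K = K₁ ⊔ K₂` into two `ℚ`-semialgebraic pieces of non-zero mass with
ALGEBRAIC mass fractions `cᵢ = (∫_{Kᵢ} k) / (∫_K k)`. If ONE change of variables `Φ : p ⊗ r → p ⊗ r'` is of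
fibre form `ψᵢ` on each piece `Kᵢ × σ` (`ψᵢ` `ℚ`-semialgebraic, injective on `σ = r.domain`, differentiable
within `σ`) and the two images `ψ₁ σ`, `ψ₂ σ` are disjoint, then `r ∼ r'`: piece `i` is a catalyst exchange
`p|Kᵢ ⊗ r → p ⊗ r'|ψᵢσ` (`stub_fibreSubstitutionTwoCatalysts`: `r.constMul cᵢ ∼ r'|ψᵢσ`), and
`[r] = [c₁ r] + [c₂ r]` (rule 1b, `c₁ + c₂ = 1`), `[r'] = [r'|ψ₁σ] + [r'|ψ₂σ]` (rule 1a, empty overlap).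
[cite: KontsevichZagier2001, §1.2 rule (1)] -/
theorem stub_twoPieceFibreSubstitution {d n : ℕ} (p : IntegralRep d) (K₁ K₂ : Set (Fin d → ℝ))
    (hK₁s : Literature.ModelTheory.ExponentialFields.IsSemialgebraic ℚ K₁)
    (hK₂s : Literature.ModelTheory.ExponentialFields.IsSemialgebraic ℚ K₂)
    (hKu : K₁ ∪ K₂ = p.domain) (hKd : Disjoint K₁ K₂)
    (hv₁ : ∫ x in K₁, p.integrand x ≠ 0) (hv₂ : ∫ x in K₂, p.integrand x ≠ 0)
    (c₁ c₂ : ℝ) (hc₁ : IsAlgebraic ℚ c₁) (hc₂ : IsAlgebraic ℚ c₂)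
    (hc₁v : c₁ * p.value = ∫ x in K₁, p.integrand x) (hc₂v : c₂ * p.value = ∫ x in K₂, p.integrand x)
    (r r' : IntegralRep n) (q q' : IntegralRep (d + n))
    (hq : q.domain = {z | (fun i => z (Fin.castAdd n i)) ∈ p.domain ∧
      (fun j => z (Fin.natAdd d j)) ∈ r.domain})
    (hqi : Set.EqOn q.integrand (fun z => p.integrand (fun i => z (Fin.castAdd n i)) *
      r.integrand (fun j => z (Fin.natAdd d j))) q.domain)
    (hq' : q'.domain = {z | (fun i => z (Fin.castAdd n i)) ∈ p.domain ∧
      (fun j => z (Fin.natAdd d j)) ∈ r'.domain})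
    (hq'i : Set.EqOn q'.integrand (fun z => p.integrand (fun i => z (Fin.castAdd n i)) *
      r'.integrand (fun j => z (Fin.natAdd d j))) q'.domain)
    (Φ : (Fin (d + n) → ℝ) → (Fin (d + n) → ℝ))
    (Φ' : (Fin (d + n) → ℝ) → (Fin (d + n) → ℝ) →L[ℝ] (Fin (d + n) → ℝ))
    (hΦ' : ∀ z ∈ q.domain, HasFDerivWithinAt Φ (Φ' z) q.domain z) (hΦinj : Set.InjOn Φ q.domain)
    (himg : q'.domain = Φ '' q.domain)
    (hjac : ∀ z ∈ q.domain, q.integrand z = q'.integrand (Φ z) * |(Φ' z).det|)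
    (ψ₁ ψ₂ : (Fin n → ℝ) → (Fin n → ℝ)) (ψ₁' ψ₂' : (Fin n → ℝ) → (Fin n → ℝ) →L[ℝ] (Fin n → ℝ))
    (hψ₁sa : IsSemialgebraicMapOn ℚ r.domain ψ₁) (hψ₂sa : IsSemialgebraicMapOn ℚ r.domain ψ₂)
    (hfib₁ : ∀ z ∈ q.domain, (fun i => z (Fin.castAdd n i)) ∈ K₁ →
      (fun j => Φ z (Fin.natAdd d j)) = ψ₁ (fun j => z (Fin.natAdd d j)))
    (hfib₂ : ∀ z ∈ q.domain, (fun i => z (Fin.castAdd n i)) ∈ K₂ →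
      (fun j => Φ z (Fin.natAdd d j)) = ψ₂ (fun j => z (Fin.natAdd d j)))
    (hψ₁' : ∀ w ∈ r.domain, HasFDerivWithinAt ψ₁ (ψ₁' w) r.domain w)
    (hψ₂' : ∀ w ∈ r.domain, HasFDerivWithinAt ψ₂ (ψ₂' w) r.domain w)
    (hψ₁inj : Set.InjOn ψ₁ r.domain) (hψ₂inj : Set.InjOn ψ₂ r.domain)
    (hdisj : Disjoint (ψ₁ '' r.domain) (ψ₂ '' r.domain)) :
    Equivalent r r' := by
  -- (0) the catalyst mass splits: `p.value = κ₁ + κ₂`, so `p.value ≠ 0` and `c₁ + c₂ = 1`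
  have hK₁K : K₁ ⊆ p.domain := by
    rw [← hKu]
    exact subset_union_left
  have hK₂K : K₂ ⊆ p.domain := by
    rw [← hKu]
    exact subset_union_right
  have hK₂m : MeasurableSet K₂ :=
    Literature.ModelTheory.ExponentialFields.IsSemialgebraic.measurableSet_holds hK₂s
  have hsplit : p.value = (∫ x in K₁, p.integrand x) + ∫ x in K₂, p.integrand x := by
    rw [IntegralRep.value, ← hKu]
    exact setIntegral_union hKd hK₂m (p.integrableOn.mono_set hK₁K) (p.integrableOn.mono_set hK₂K)
  have hκ : p.value ≠ 0 := by
    intro h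
    apply hv₁
    rw [← hc₁v, h, mul_zero]
  have hsum : c₁ + c₂ = 1 := by
    apply mul_right_cancel₀ hκ
    rw [add_mul, hc₁v, hc₂v, one_mul, ← hsplit]
  -- the pieces are non-empty and the fibre maps send `σ` into `σ'`
  have hK₁ne : K₁.Nonempty := twoPiece_nonempty_of_setIntegral_ne_zero hv₁
  have hK₂ne : K₂.Nonempty := twoPiece_nonempty_of_setIntegral_ne_zero hv₂
  have hsub₁ : ψ₁ '' r.domain ⊆ r'.domain :=
    twoPiece_image_subset hK₁K hK₁ne hq hq' Φ himg ψ₁ hfib₁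
  have hsub₂ : ψ₂ '' r.domain ⊆ r'.domain :=
    twoPiece_image_subset hK₂K hK₂ne hq hq' Φ himg ψ₂ hfib₂
  -- the target pieces `r'ᵢ = r'|ψᵢσ` (images semialgebraic by Tarski–Seidenberg)
  have himg₁s : IsSemialgebraic ℚ (ψ₁ '' r.domain) :=
    IsSemialgebraicMapOn.isSemialgebraic_image_holds hψ₁sa Subset.rfl r.isSemialgebraic_domain
  have himg₂s : IsSemialgebraic ℚ (ψ₂ '' r.domain) :=
    IsSemialgebraicMapOn.isSemialgebraic_image_holds hψ₂sa Subset.rfl r.isSemialgebraic_domain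
  obtain ⟨r'₁, hr'₁, hr'₁i⟩ : ∃ r'₁ : IntegralRep n,
      r'₁.domain = ψ₁ '' r.domain ∧ r'₁.integrand = r'.integrand :=
    ⟨r'.restrict _ himg₁s hsub₁, rfl, rfl⟩
  obtain ⟨r'₂, hr'₂, hr'₂i⟩ : ∃ r'₂ : IntegralRep n,
      r'₂.domain = ψ₂ '' r.domain ∧ r'₂.integrand = r'.integrand :=
    ⟨r'.restrict _ himg₂s hsub₂, rfl, rfl⟩
  -- points of the other piece are kept out of `ψᵢ σ` by disjointness of the two images
  have hmemq : ∀ z, z ∈ q.domain ↔ (fun i => z (Fin.castAdd n i)) ∈ p.domain ∧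
      (fun j => z (Fin.natAdd d j)) ∈ r.domain := fun z => by rw [hq]; rfl
  have hhead : ∀ z ∈ q.domain, (fun i => z (Fin.castAdd n i)) ∈ K₁ ∪ K₂ := fun z hz => by
    rw [hKu]
    exact ((hmemq z).1 hz).1
  have hout₁ : ∀ z ∈ q.domain, (fun i => z (Fin.castAdd n i)) ∉ K₁ →
      (fun j => Φ z (Fin.natAdd d j)) ∉ ψ₁ '' r.domain := by
    intro z hz hK h₁
    have h₂ : (fun j => Φ z (Fin.natAdd d j)) ∈ ψ₂ '' r.domain := by
      rw [hfib₂ z hz ((hhead z hz).resolve_left hK)]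
      exact mem_image_of_mem ψ₂ ((hmemq z).1 hz).2
    exact Set.disjoint_left.1 hdisj h₁ h₂
  have hout₂ : ∀ z ∈ q.domain, (fun i => z (Fin.castAdd n i)) ∉ K₂ →
      (fun j => Φ z (Fin.natAdd d j)) ∉ ψ₂ '' r.domain := by
    intro z hz hK h₂
    have h₁ : (fun j => Φ z (Fin.natAdd d j)) ∈ ψ₁ '' r.domain := by
      rw [hfib₁ z hz ((hhead z hz).resolve_right hK)]
      exact mem_image_of_mem ψ₁ ((hmemq z).1 hz).2
    exact Set.disjoint_left.1 hdisj h₁ h₂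
  -- (5) the two catalyst exchanges: `r.constMul cᵢ ∼ r'ᵢ`
  have h₁ : Equivalent (r.constMul c₁ hc₁) r'₁ :=
    twoPiece_pieceDescent p hκ K₁ hK₁s hK₁K hv₁ c₁ hc₁ hc₁v r r' q q' hq hqi hq' hq'i Φ Φ' hΦ' hΦinj
      himg hjac ψ₁ ψ₁' hψ₁sa hfib₁ hψ₁' hψ₁inj hout₁ r'₁ hr'₁ hr'₁i
  have h₂ : Equivalent (r.constMul c₂ hc₂) r'₂ :=
    twoPiece_pieceDescent p hκ K₂ hK₂s hK₂K hv₂ c₂ hc₂ hc₂v r r' q q' hq hqi hq' hq'i Φ Φ' hΦ' hΦinj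
      himg hjac ψ₂ ψ₂' hψ₂sa hfib₂ hψ₂' hψ₂inj hout₂ r'₂ hr'₂ hr'₂i
  -- (6) rule (1b) among the bases: `[r] − [c₁ r] − [c₂ r]`, since `c₁ + c₂ = 1`
  have h₆ : of r - of (r.constMul c₁ hc₁) - of (r.constMul c₂ hc₂) ∈ relations := by
    refine integrandAddRel_subset_relations
      ⟨n, r, r.constMul c₁ hc₁, r.constMul c₂ hc₂, rfl, rfl, fun w _ => ?_, rfl⟩
    simp only [Pi.add_apply, IntegralRep.integrand_constMul]
    rw [← add_mul, hsum, one_mul]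
  -- (7) rule (1a) on the target: `[r'] − [r'₁] − [r'₂]` (`σ' = ψ₁ σ ∪ ψ₂ σ`, empty overlap)
  have h₇ : of r' - of r'₁ - of r'₂ ∈ relations := by
    refine domainAddRel_subset_relations ⟨n, r', r'₁, r'₂, ?_, ?_, ?_, ?_, rfl⟩
    · rw [hr'₁, hr'₂]
      exact Subset.antisymm
        (twoPiece_subset_union_image hKu (hK₁ne.mono hK₁K) hq hq' Φ himg ψ₁ ψ₂ hfib₁ hfib₂)
        (union_subset hsub₁ hsub₂)
    · rw [hr'₁, hr'₂, Set.disjoint_iff_inter_eq_empty.mp hdisj, measure_empty]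
    · rw [hr'₁i]
      exact fun _ _ => rfl
    · rw [hr'₂i]
      exact fun _ _ => rfl
  -- (8) combine in the free abelian group
  have hcomb : of r - of r' = (of r - of (r.constMul c₁ hc₁) - of (r.constMul c₂ hc₂)) +
      (of (r.constMul c₁ hc₁) - of r'₁) + (of (r.constMul c₂ hc₂) - of r'₂) -
      (of r' - of r'₁ - of r'₂) := by
    abel
  change of r - of r' ∈ relations
  rw [hcomb]
  exact relations.sub_mem (relations.add_mem (relations.add_mem h₆ h₁) h₂) h₇

end Summit.KontsevichZagierPeriods.KontsevichZagierPeriods.BetaCancellationLine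

end
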